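import Summits.RiemannHypothesis.RiemannHypothesis.Theorems.WeilTwoPrimeDeflC83XBase
import Summits.RiemannHypothesis.RiemannHypothesis.Theorems.WeilBlockHpLegendreCoeff
import HarnessLib

/-!
# Deflated phantom two-prime certificate C83X: the even Bessel-block claim rows `Hp = C H Cᵀ` — part `CertHpE`, by Legendre orthogonality (self-contained)

Replaces the 28 one-parity row files `…HpCheckE0–27` (`checkHpRowT`, ≈ 40 s of kernel time per row): the even block basis `C`
(`weilCertDeflC83XBase.Cb 0 = weilBlocks136C`) IS the Legendre coefficient table `HpLegendre.legendreTable 0 136` (one `decide`), so every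
claim row is Legendre orthogonality `∫_{-1}^{1} P_{2i} P_{2j} = [i=j]·2/(2(2i)+1)` (prover B g9's lever). Same module and theorem names as
the row-assembly version it supersedes (`checkHpRows0_weilCertDeflC83X`), so `…CertB0` imports it unchanged.

SELF-CONTAINED VARIANT (prover A g20, 2026-08-24): the Legendre-orthogonality bridge (`P_{2i+p}` as a parity sum, the Gram double sum as
`a ∫ P_{2i+p} P_{2j+p}`, its diagonality, and `checkHpRow` from `c.Cb p = legendreTable p nb`) is proved INSIDE the main theorem as local
lemmas, directly from `WeilBlockHpLegendreCoeff` + `Literature.Analysis.SpecialFunctions.LegendrePolynomials`; the argument is the one of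
`Theorems/WeilBlockHpLegendre.lean` (prover B g9), whose hub build item is dead tonight (ops-buildfix UNBUILT-ACCEPTED-20260824T2100, «rc75 NO-HOST»),
so that this file's imports all have hub oleans. No new top-level declaration besides the two below. Pure proof file. [folklore]
-/

set_option linter.dupNamespace false
set_option Elab.async false

noncomputable section

namespace Summit.RiemannHypothesis.RiemannHypothesis.Theorems.EvenWinsBeyondArch

open Polynomial Finset MeasureTheory intervalIntegral
open scoped Nat BigOperators
open Literature.Analysis.SpecialFunctions Literature.NumberTheory.LFunctions HpLegendre

set_option maxHeartbeats 0 in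
/-- The even block basis of certificate C83X is the Legendre coefficient table (`P_{2i}` in powers `y^{2k}`). [folklore] -/
theorem cb0_eq_legendreTable_weilCertDeflC83X : weilCertDeflC83XBase.Cb 0 = legendreTable 0 136 := by
  decide +kernel

set_option maxHeartbeats 800000 in
/-- All claim rows of the even Bessel block of certificate C83X are checked (by Legendre orthogonality; bridge proved locally). [folklore] -/
theorem checkHpRows0_weilCertDeflC83X : ∀ k < weilCertDeflC83XBase.nb, weilCertDeflC83XBase.checkHpRow weilCertDeflC83XHpE 0 k = true := by
  /- (1) `P_{2i+p}(x) = Σ_{k<N} c(2i+p,2k+p) x^{2k+p}` for `i < N`, `p ≤ 1`. -/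
  have eval_sum : ∀ {p : ℕ} (_ : p ≤ 1) {N i : ℕ} (_ : i < N) (x : ℝ),
      (legendre (2 * i + p)).eval x = ∑ k ∈ range N, (legendreCoeffQ (2 * i + p) (2 * k + p) : ℝ) * x ^ (2 * k + p) := by
    intro p hp N i hi x
    have hdeg : (legendre (2 * i + p)).natDegree < 2 * N + p := by
      rw [natDegree_legendre]; omega
    rw [eval_eq_sum_range' hdeg]
    simp only [coeff_legendre]
    have hT : (range N).image (fun k ↦ 2 * k + p) ⊆ range (2 * N + p) := by
      intro a ha
      obtain ⟨k, hk, rfl⟩ := Finset.mem_image.1 ha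
      exact Finset.mem_range.2 (by have := Finset.mem_range.1 hk; omega)
    rw [← Finset.sum_subset hT]
    · rw [Finset.sum_image (fun k _ l _ h ↦ by omega)]
    · intro a ha hnot
      have ha' := Finset.mem_range.1 ha
      have hpar : ¬ Even (a + (2 * i + p)) := by
        intro hev
        apply hnot
        obtain ⟨m, hm⟩ := hev
        refine Finset.mem_image.2 ⟨(a - p) / 2, Finset.mem_range.2 (by omega), by omega⟩
      rw [legendreCoeffQ_eq_zero_of_parity hpar, Rat.cast_zero, zero_mul]
  /- (2) `∫_{-1}^{1} x^{2m} = 2/(2m+1)`. -/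
  have int_pow_even : ∀ m : ℕ, ∫ x in (-1 : ℝ)..1, x ^ (2 * m) = 2 / (2 * m + 1) := by
    intro m
    rw [integral_pow]
    rw [show (-1 : ℝ) ^ (2 * m + 1) = -1 from by rw [pow_succ, pow_mul]; norm_num]
    push_cast
    ring
  /- (3) the Gram double sum is `a ∫ P_{2i+p} P_{2j+p}`. -/
  have gram_int : ∀ {p : ℕ} (_ : p ≤ 1) {N i j : ℕ} (_ : i < N) (_ : j < N) (a : ℝ),
      ∑ k ∈ range N, ∑ l ∈ range N, (legendreCoeffQ (2 * i + p) (2 * k + p) : ℝ) * (legendreCoeffQ (2 * j + p) (2 * l + p) : ℝ) *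
          (2 * a / (((2 * k + p : ℕ) : ℝ) + ((2 * l + p : ℕ) : ℝ) + 1))
        = a * ∫ x in (-1 : ℝ)..1, (legendre (2 * i + p)).eval x * (legendre (2 * j + p)).eval x := by
    intro p hp N i j hi hj a
    have hint : ∫ x in (-1 : ℝ)..1, (legendre (2 * i + p)).eval x * (legendre (2 * j + p)).eval x
        = ∑ k ∈ range N, ∑ l ∈ range N, (legendreCoeffQ (2 * i + p) (2 * k + p) : ℝ) * (legendreCoeffQ (2 * j + p) (2 * l + p) : ℝ) *
            (2 / (2 * ((k + l + p : ℕ) : ℝ) + 1)) := by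
      have hfun : ∀ x : ℝ, (legendre (2 * i + p)).eval x * (legendre (2 * j + p)).eval x
          = ∑ k ∈ range N, ∑ l ∈ range N, (legendreCoeffQ (2 * i + p) (2 * k + p) : ℝ) * (legendreCoeffQ (2 * j + p) (2 * l + p) : ℝ) *
              x ^ (2 * (k + l + p)) := by
        intro x
        rw [eval_sum hp hi, eval_sum hp hj, Finset.sum_mul_sum]
        refine Finset.sum_congr rfl fun k _ ↦ Finset.sum_congr rfl fun l _ ↦ ?_
        rw [show 2 * (k + l + p) = (2 * k + p) + (2 * l + p) by ring, pow_add]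
        ring
      simp_rw [hfun]
      rw [intervalIntegral.integral_finsetSum (fun k _ ↦ ?_)]
      · refine Finset.sum_congr rfl fun k _ ↦ ?_
        rw [intervalIntegral.integral_finsetSum (fun l _ ↦ ?_)]
        · refine Finset.sum_congr rfl fun l _ ↦ ?_
          rw [intervalIntegral.integral_const_mul, int_pow_even]
        · exact (continuous_const.mul (continuous_pow _)).intervalIntegrable _ _
      · exact (continuous_finsetSum _ fun l _ ↦ continuous_const.mul (continuous_pow _)).intervalIntegrable _ _
    rw [hint, Finset.mul_sum]
    refine Finset.sum_congr rfl fun k _ ↦ ?_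
    rw [Finset.mul_sum]
    refine Finset.sum_congr rfl fun l _ ↦ ?_
    push_cast
    ring
  /- (4) the Gram double sum is diagonal: `[i = j] · 2a/(2(2i+p)+1)`. -/
  have gram : ∀ {p : ℕ} (_ : p ≤ 1) {N i j : ℕ} (_ : i < N) (_ : j < N) (a : ℝ),
      ∑ k ∈ range N, ∑ l ∈ range N, (legendreCoeffQ (2 * i + p) (2 * k + p) : ℝ) * (legendreCoeffQ (2 * j + p) (2 * l + p) : ℝ) *
          (2 * a / (((2 * k + p : ℕ) : ℝ) + ((2 * l + p : ℕ) : ℝ) + 1))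
        = if i = j then 2 * a / (2 * ((2 * i + p : ℕ) : ℝ) + 1) else 0 := by
    intro p hp N i j hi hj a
    rw [gram_int hp hi hj]
    by_cases hij : i = j
    · subst hij
      rw [if_pos rfl]
      simp_rw [← pow_two]
      rw [integral_legendre_sq]
      push_cast
      ring
    · rw [if_neg hij]
      rcases Nat.lt_or_gt_of_ne hij with h | h
      · rw [show (fun x ↦ (legendre (2 * i + p)).eval x * (legendre (2 * j + p)).eval x)
            = fun x ↦ (legendre (2 * j + p)).eval x * (legendre (2 * i + p)).eval x from funext fun x ↦ mul_comm _ _]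
        rw [integral_legendre_mul_legendre_eq_zero (by omega), mul_zero]
      · rw [integral_legendre_mul_legendre_eq_zero (by omega), mul_zero]
  /- (5) `checkHpRow` from the Legendre coefficient table. -/
  have bridge : ∀ (c : WeilCert) {p : ℕ} (_ : p ≤ 1) {Hp : List (List ℚ)}
      (_ : ∀ i < c.nb, ∀ k < c.nb, getM (c.Cb p) i k = legendreCoeffQ (2 * i + p) (2 * k + p))
      (_ : ∀ i < c.nb, ∀ j < c.nb, getM Hp i j = if i = j then 2 * c.a0 / (2 * ((2 * i + p : ℕ) : ℚ) + 1) else 0),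
      ∀ i < c.nb, c.checkHpRow Hp p i = true := by
    intro c p hp Hp hC hHp i hi
    unfold WeilCert.checkHpRow
    refine WeilCert2.allBelow_of_forall fun j hj ↦ ?_
    rw [decide_eq_true_eq, hHp i hi j hj]
    have hch : ∀ l < c.nb, getV (c.chRow p i) l = sumR c.nb fun k ↦ getM (c.Cb p) i k * c.hBlkQ p k l := by
      intro l hl
      unfold WeilCert.chRow
      rw [getV_tabV _ hl]
    apply Rat.cast_injective (α := ℝ)
    rw [sumR_eq_sum]
    push_cast
    rw [Finset.sum_congr rfl fun l hl ↦ by rw [hch l (Finset.mem_range.1 hl), sumR_eq_sum]]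
    push_cast
    have hrhs : ∑ l ∈ range c.nb, (∑ k ∈ range c.nb, (getM (c.Cb p) i k : ℝ) * (c.hBlkQ p k l : ℝ)) * (getM (c.Cb p) j l : ℝ)
        = ∑ k ∈ range c.nb, ∑ l ∈ range c.nb, (legendreCoeffQ (2 * i + p) (2 * k + p) : ℝ) *
            (legendreCoeffQ (2 * j + p) (2 * l + p) : ℝ) * (2 * (c.a0 : ℝ) / (((2 * k + p : ℕ) : ℝ) + ((2 * l + p : ℕ) : ℝ) + 1)) := by
      simp_rw [Finset.sum_mul]
      rw [Finset.sum_comm]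
      refine Finset.sum_congr rfl fun k hk ↦ ?_
      refine Finset.sum_congr rfl fun l hl ↦ ?_
      rw [hC i hi k (Finset.mem_range.1 hk), hC j hj l (Finset.mem_range.1 hl)]
      unfold WeilCert.hBlkQ
      push_cast
      ring
    rw [hrhs, gram hp hi hj]
    split_ifs <;> push_cast <;> ring
  /- (6) the certificate: `Cb 0 = legendreTable 0 136` and `HpE` is the diagonal table. -/
  refine bridge weilCertDeflC83XBase (p := 0) (by norm_num)
    (fun i hi k _ ↦ by rw [cb0_eq_legendreTable_weilCertDeflC83X]; exact getM_legendreTable (by norm_num) hi k) fun i hi j hj ↦ ?_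
  have hi' : i < 136 := hi
  have hj' : j < 136 := hj
  unfold weilCertDeflC83XHpE
  rw [getM_tabM _ hi' hj']
  rw [show weilCertDeflC83XBase.a0 = 83 / 100 from rfl]
  split_ifs
  · push_cast; ring
  · rfl

end Summit.RiemannHypothesis.RiemannHypothesis.Theorems.EvenWinsBeyondArch
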